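import Mathlib
import Literature.Combinatorics.Enumerative.BoustrophedonTransform
import HarnessLib

/-!
# The boustrophedon numbers `π(n,k,i)` and Entringer's formula for `E_{n,k}`
# (Millar–Sloane–Young 1996, §2 eq. (11)–(12), Remark, Propositions 3–4; Entringer 1966)

[cite: MillarSloaneYoung1996, §2 eq. (11), (12), Remark and Propositions 3–4 (JCTA 76 (1996) 44–54 = arXiv:math/0205218, pp. 3–4)]
[cite: Entringer1966 (Nieuw Arch. Wisk. (3) 14 (1966) 241–246; the formula for E_{n,k}, as reproduced in MSY Proposition 3)]

This file completes the story of `Literature.Combinatorics.Enumerative.BoustrophedonTransform` (the triangle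
`T_{n,k}` of a sequence `a`, eq. (5), its closed form `skew_eq_conv`, Theorem 1) with the part of MSY §2 that
names the individual coefficients — the *boustrophedon numbers* `π(n,k,i)` — and expresses all of them through the
Euler numbers `E_n` and the Entringer numbers `E_{n,k}` (`Literature.Combinatorics.Enumerative.EntringerNumbers`).

## Source (verbatim)

* (11)–(12): «Let π(n,k,i) denote the number of paths in Γ from the node labeled T_{i,0} to the node labeled
  T_{n,k}.  It follows from the rule for constructing the triangle that the numbers T_{n,k} are given by
  (11) T_{n,k} = Σ_{i=0}^{n} π(n,k,i) a_i.  From Section 1 we know that the boustrophedon transform of the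
  sequence 1, 0, 0, 0, … is E_0, E_1, E_2, E_3, …, and so (from (11)) (12) E_n = π(n,n,0) (n ≥ 0).»
* «Proposition 2. π(n,n,k) = binom(n,k) E_{n−k}, for 0 ≤ k ≤ n.»
* «Remark. With only a little more effort we can determine all the “boustrophedon numbers” π(n,k,i).  Note that
  π(n,0,i) = 0 for n ≥ 1, 0 ≤ i ≤ n−1, and π(n,0,n) = 1.
  Proposition 3. For n ≥ 1, 0 ≤ k ≤ n−1,
  π(n,k,0) = E_{n,k} = Σ_{r=0}^{[(k−1)/2]} (−1)^r binom(k,2r+1) E_{n−2r−1}.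
  Proof. π(n,k,0) = E_{n,k} follows from (11) and the definition of E_{n,k} (see (2)), and the formula for
  E_{n,k} is given in [Ent66]. ∎»
* «Proposition 4. For n ≥ 2, 0 < k < n, 0 < i ≤ n,
  (20) π(n,k,i) = Σ_{s=0}^{min{k,n−i}} binom(k,s) binom(n−k,n−i−s) π(n−i,s,0).
  Sketch of proof. … In the box diagram for Q itself, the star in the last row divides the remaining stars into
  two sets of sizes s (to the right) and n−i−s (to the left), and the binomial coefficients in (20) count the ways
  in which the corresponding columns can be selected. ∎
  Propositions 1–4 together express all the boustrophedon numbers in terms of the E_n's, and via (11) give an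
  explicit formula for every entry in the triangle (9).»
* «[Ent66] R. C. Entringer, A combinatorial interpretation of the Euler and Bernoulli numbers, Nieuw. Arch.
  Wisk., 14 (1966), 241–246.»

## What is typed, and how it is proved

* §1 **Entringer's formula** `entringer_formula` (★★★): for `n ≥ 1`, `0 ≤ k ≤ n−1`,
  `E_{n,k} = Σ_{r=0}^{[(k−1)/2]} (−1)^r binom(k,2r+1) E_{n−2r−1}` in `ℤ`.  MSY only cite [Ent66] for it, and the
  1966 note is not in our holdings; the proof given here is elementary and self-contained: the boustrophedon rule
  (1) applied twice gives the *second-order* rule `E_{m+2,l+2} − 2E_{m+2,l+1} + E_{m+2,l} = −E_{m,l}`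
  (`entringer_three_term`); Pascal's rule twice shows that the right-hand sides obey the same rule
  (`entringerSum_succ_succ`), and the two sides agree at `k = 0` (`E_{n,0} = 0`) and `k = 1` (`E_{n,1} = E_{n−1}`);
  induction on `k`.  The range `k ≤ n−1` is sharp (`entringer_formula_fails_at_diagonal`).  Corollary at
  `k = n−1`: `E_{n+1} = Σ_r (−1)^r binom(n,2r+1) E_{n−2r}` (`eulerZigzag_succ_eq_alternating_sum`).
* §2 **The boustrophedon numbers** `pathCount n k i = π(n,k,i)`, *defined* as the entry `T_{n,k}` of the triangle
  of `δ_i` (the coefficient of `a_i`); MSY define `π` by counting paths in the directed graph `Γ` and derive (11) from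
  the rule of the triangle — we do not formalize `Γ`, and take (11) (`triangle_eq_sum_pathCount`, proved from the
  linearity of the rule (5)) as the bridge.  Row rule `pathCount_succ_row`, `π(n,k,i) = 0` for `i > n`, `π(n,k,n) = 1`.
* §3 **All the boustrophedon numbers**: the Remark (`pathCount_zero`), (12) (`pathCount_end_zero`), Proposition 2
  (`pathCount_end`), Proposition 3 (`pathCount_source_zero`, `proposition_three`), Proposition 4
  (`pathCount_eq_sum`, from the closed form `skew_eq_conv` of the whole triangle by collapsing the indicator of
  `δ_i` and reflecting `u = k − s`; stated for all `0 ≤ i, k ≤ n` with the upper limit `n − i` — the printed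
  `min{k, n−i}` only drops the vanishing terms `s > k`), and the closing sentence (`triangle_explicit`).
  Values: `pathCount_values`, `entringer_formula_row_six`.

No new named facts (net debt 0); everything is a theorem over `Mathlib` + the two Literature files above.
-/

namespace Literature.Combinatorics.Enumerative
namespace Boustrophedon

open Finset

/-! ### §1 Entringer's formula `E_{n,k} = Σ_r (−1)^r binom(k,2r+1) E_{n−2r−1}` -/

/-- A second-order form of the boustrophedon rule: `E_{m+2,l+2} − 2E_{m+2,l+1} + E_{m+2,l} = −E_{m,l}`
(`0 ≤ l ≤ m`), written additively — two applications of the rule (1) in row `m+2` and one in row `m+1`.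
[cite: MillarSloaneYoung1996, §1 eq. (1) («E_{n+1,k+1} = E_{n+1,k} + E_{n,n−k} (n ≥ k ≥ 0)»); used for §2 Proposition 3] -/
theorem entringer_three_term {m l : ℕ} (hl : l ≤ m) :
    entringer (m + 2) (l + 2) + entringer (m + 2) l + entringer m l = 2 * entringer (m + 2) (l + 1) := by
  have h1 : entringer (m + 2) (l + 2) = entringer (m + 2) (l + 1) + entringer (m + 1) (m + 1 - (l + 1)) :=
    entringer_succ_succ (n := m + 1) (k := l + 1) (by omega)
  have h2 : entringer (m + 2) (l + 1) = entringer (m + 2) l + entringer (m + 1) (m + 1 - l) :=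
    entringer_succ_succ (n := m + 1) (k := l) (by omega)
  have h3 : entringer (m + 1) (m - l + 1) = entringer (m + 1) (m - l) + entringer m (m - (m - l)) :=
    entringer_succ_succ (n := m) (k := m - l) (by omega)
  rw [show m + 1 - (l + 1) = m - l by omega] at h1
  rw [show m + 1 - l = m - l + 1 by omega] at h2
  rw [show m - (m - l) = l by omega] at h3
  omega

/-- The right-hand side of Entringer's formula with `M` terms:
`S_M(n,k) = Σ_{r<M} (−1)^r binom(k,2r+1) E_{n−2r−1}` (the printed sum is `S_{[(k−1)/2]+1}`; the terms with
`2r+1 > k` vanish). [cite: MillarSloaneYoung1996, §2 Proposition 3 («E_{n,k} = Σ_{r=0}^{[(k−1)/2]} (−1)^r binom(k,2r+1) E_{n−2r−1}»)] -/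
def entringerSum (M n k : ℕ) : ℤ :=
  ∑ r ∈ range M, (-1 : ℤ) ^ r * (k.choose (2 * r + 1) : ℤ) * (eulerZigzag (n - 2 * r - 1) : ℤ)

/-- Truncation: the terms with `r ≥ [(k+1)/2]`, i.e. `2r+1 > k`, vanish.
[cite: MillarSloaneYoung1996, §2 Proposition 3 (the upper limit [(k−1)/2])] -/
theorem entringerSum_of_le {M n k : ℕ} (hM : (k + 1) / 2 ≤ M) :
    entringerSum M n k = entringerSum ((k + 1) / 2) n k := by
  unfold entringerSum
  symm
  refine sum_subset (fun x hx => mem_range.2 (lt_of_lt_of_le (mem_range.1 hx) hM)) fun r _ hr' => ?_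
  have : k < 2 * r + 1 := by
    rw [mem_range, not_lt] at hr'
    omega
  rw [Nat.choose_eq_zero_of_lt this, Nat.cast_zero, mul_zero, zero_mul]

/-- Pascal's rule twice: `binom(k+2,j+2) − 2binom(k+1,j+2) + binom(k,j+2) = binom(k,j)`, additively.
[cite: MillarSloaneYoung1996, §2 Proposition 3 (proof step)] -/
theorem choose_second_difference (k j : ℕ) :
    (k + 2).choose (j + 2) + k.choose (j + 2) = k.choose j + 2 * (k + 1).choose (j + 2) := by
  have h1 : (k + 2).choose (j + 2) = (k + 1).choose (j + 1) + (k + 1).choose (j + 2) :=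
    Nat.choose_succ_succ (k + 1) (j + 1)
  have h2 : (k + 1).choose (j + 1) = k.choose j + k.choose (j + 1) := Nat.choose_succ_succ k j
  have h3 : (k + 1).choose (j + 2) = k.choose (j + 1) + k.choose (j + 2) := Nat.choose_succ_succ k (j + 1)
  omega

/-- The sums `S` satisfy the same second-order rule: `S(n+2,k+2) − 2S(n+2,k+1) + S(n+2,k) = −S(n,k)`
(with one more term on the longer row). [cite: MillarSloaneYoung1996, §2 Proposition 3 (proof step)] -/
theorem entringerSum_succ_succ (M n k : ℕ) :
    entringerSum (M + 1) (n + 2) (k + 2) + entringerSum (M + 1) (n + 2) k + entringerSum M n k =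
      2 * entringerSum (M + 1) (n + 2) (k + 1) := by
  have hsub : ∀ i : ℕ, n + 2 - 2 * (i + 1) - 1 = n - 2 * i - 1 := fun i => by omega
  have key : ∀ i : ℕ, (((k + 2).choose (2 * (i + 1) + 1) : ℕ) : ℤ) + (k.choose (2 * (i + 1) + 1) : ℤ) =
      (k.choose (2 * i + 1) : ℤ) + 2 * ((k + 1).choose (2 * (i + 1) + 1) : ℤ) := by
    intro i
    have h := choose_second_difference k (2 * i + 1)
    rw [show 2 * i + 1 + 2 = 2 * (i + 1) + 1 by ring] at h
    exact_mod_cast h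
  have h0 : ∀ j : ℕ, (j.choose (2 * 0 + 1) : ℤ) = j := fun j => by simp
  simp only [entringerSum, sum_range_succ', hsub, pow_zero, one_mul, h0, pow_succ]
  have hS : ∀ i ∈ range M,
      (-1 : ℤ) ^ i * (-1) * (((k + 2).choose (2 * (i + 1) + 1) : ℕ) : ℤ) * (eulerZigzag (n - 2 * i - 1) : ℤ) =
        2 * ((-1 : ℤ) ^ i * (-1) * (((k + 1).choose (2 * (i + 1) + 1) : ℕ) : ℤ) * (eulerZigzag (n - 2 * i - 1) : ℤ)) -
        (-1 : ℤ) ^ i * (-1) * ((k.choose (2 * (i + 1) + 1) : ℕ) : ℤ) * (eulerZigzag (n - 2 * i - 1) : ℤ) -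
        (-1 : ℤ) ^ i * ((k.choose (2 * i + 1) : ℕ) : ℤ) * (eulerZigzag (n - 2 * i - 1) : ℤ) := by
    intro i _
    have := key i
    linear_combination (-1 : ℤ) ^ i * (-1) * (eulerZigzag (n - 2 * i - 1) : ℤ) * this
  rw [sum_congr rfl hS, sum_sub_distrib, sum_sub_distrib, ← mul_sum]
  push_cast
  ring

/-- ★★ `E_{n,k} = S(n,k)` for `0 ≤ k ≤ n − 1`: induction on `k` by the second-order rule, from `E_{n,0} = 0`
and `E_{n,1} = E_{n−1}`. [cite: MillarSloaneYoung1996, §2 Proposition 3 («the formula for E_{n,k} is given in [Ent66]»); Entringer1966] -/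
theorem entringer_eq_entringerSum (k : ℕ) :
    ∀ n : ℕ, k < n → (entringer n k : ℤ) = entringerSum ((k + 1) / 2) n k := by
  induction k using Nat.strong_induction_on with
  | _ k ih =>
    intro n hn
    rcases k with _ | _ | k
    · obtain ⟨n, rfl⟩ : ∃ n', n = n' + 1 := ⟨n - 1, by omega⟩
      simp [entringerSum, entringer_succ_zero]
    · obtain ⟨n, rfl⟩ : ∃ n', n = n' + 1 := ⟨n - 1, by omega⟩
      rw [entringer_succ_succ (Nat.zero_le _), entringer_succ_zero, Nat.sub_zero, entringer_self]
      simp [entringerSum]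
    · obtain ⟨m, rfl⟩ : ∃ m, n = m + 2 := ⟨n - 2, by omega⟩
      have hkm : k < m := by omega
      have three := entringer_three_term (m := m) (l := k) hkm.le
      have i1 := ih (k + 1) (by omega) (m + 2) (by omega)
      have i0 := ih k (by omega) (m + 2) (by omega)
      have i2 := ih k (by omega) m hkm
      rw [← entringerSum_of_le (M := k + 1 + 1) (by omega)] at i1 i0 ⊢
      rw [← entringerSum_of_le (M := k + 1) (by omega)] at i2
      have hb := entringerSum_succ_succ (k + 1) m k
      have hz := congrArg (Nat.cast : ℕ → ℤ) three
      push_cast at hz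
      linear_combination hz - hb + 2 * i1 - i0 - i2

/-- ★★★ **Entringer's formula** [Ent66] (MSY Proposition 3): for `n ≥ 1` and `0 ≤ k ≤ n − 1`,
`E_{n,k} = Σ_{r=0}^{[(k−1)/2]} (−1)^r binom(k, 2r+1) E_{n−2r−1}` (an identity of integers; the range
`r ≤ [(k−1)/2]` is `r < [(k+1)/2]`).
[cite: MillarSloaneYoung1996, §2 Proposition 3 («For n ≥ 1, 0 ≤ k ≤ n−1, π(n,k,0) = E_{n,k} = Σ_{r=0}^{[(k−1)/2]} (−1)^r binom(k,2r+1) E_{n−2r−1}»); Entringer1966 (the original)] -/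
theorem entringer_formula {n k : ℕ} (hn : 1 ≤ n) (hk : k ≤ n - 1) :
    (entringer n k : ℤ) =
      ∑ r ∈ range ((k + 1) / 2), (-1 : ℤ) ^ r * (k.choose (2 * r + 1) : ℤ) * (eulerZigzag (n - 2 * r - 1) : ℤ) :=
  entringer_eq_entringerSum k n (by omega)

/-- The hypothesis `k ≤ n − 1` is needed: at `(n,k) = (2,2)` the sum is `2 ≠ E_{2,2} = 1`.
[cite: MillarSloaneYoung1996, §2 Proposition 3 (the range «0 ≤ k ≤ n−1»)] -/
theorem entringer_formula_fails_at_diagonal : entringerSum ((2 + 1) / 2) 2 2 = 2 ∧ entringer 2 2 = 1 := by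
  refine ⟨?_, by decide⟩
  simp [entringerSum]
  decide

/-- First instances: `E_{n,1} = E_{n−1}`, `E_{n,2} = 2E_{n−1}`, `E_{n,3} = 3E_{n−1} − E_{n−3}` (in their ranges).
[cite: MillarSloaneYoung1996, §2 Proposition 3] -/
theorem entringer_formula_small (n : ℕ) :
    (entringer (n + 2) 1 : ℤ) = eulerZigzag (n + 1) ∧ (entringer (n + 3) 2 : ℤ) = 2 * eulerZigzag (n + 2) ∧
      (entringer (n + 4) 3 : ℤ) = 3 * eulerZigzag (n + 3) - eulerZigzag (n + 1) := by
  refine ⟨?_, ?_, ?_⟩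
  · rw [entringer_formula (by omega) (by omega)]
    simp
  · rw [entringer_formula (by omega) (by omega)]
    simp [Nat.choose]
  · rw [entringer_formula (by omega) (by omega)]
    simp [sum_range_succ, Nat.choose]
    ring

/-- ★ Corollary (`k = n − 1`, using `E_{n,n−1} = E_{n,n} = E_n` for `n ≥ 2`): the Euler numbers satisfy
`E_{n+1} = Σ_{r=0}^{[(n−1)/2]} (−1)^r binom(n,2r+1) E_{n−2r}` (`n ≥ 1`), e.g. `E_5 = 4E_4 − 4E_2 = 16`.
[cite: MillarSloaneYoung1996, §2 Proposition 3 (at k = n−1) with §1 eq. (1)] -/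
theorem eulerZigzag_succ_eq_alternating_sum {n : ℕ} (hn : 1 ≤ n) :
    (eulerZigzag (n + 1) : ℤ) =
      ∑ r ∈ range ((n + 1) / 2), (-1 : ℤ) ^ r * (n.choose (2 * r + 1) : ℤ) * (eulerZigzag (n - 2 * r) : ℤ) := by
  obtain ⟨m, rfl⟩ : ∃ m, n = m + 1 := ⟨n - 1, by omega⟩
  have h : entringer (m + 2) (m + 2) = entringer (m + 2) (m + 1) := by
    rw [entringer_succ_succ le_rfl, Nat.sub_self, entringer_succ_zero, add_zero]
  rw [← entringer_self, h, entringer_formula (by omega) (by omega)]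
  refine sum_congr rfl fun r _ => ?_
  rw [show m + 2 - 2 * r - 1 = m + 1 - 2 * r by omega]

/-- Row six of the triangle from the formula: `E_{6,3} = 3E_5 − E_3 = 46`, `E_{6,4} = 4E_5 − 4E_3 = 56`,
`E_{6,5} = 5E_5 − 10E_3 + E_1 = 61`. [cite: MillarSloaneYoung1996, §2 Proposition 3; Stanley2010AltPermSurvey, §2 (row 0 16 32 46 56 61 61)] -/
theorem entringer_formula_row_six :
    (3 * eulerZigzag 5 - eulerZigzag 3 : ℤ) = 46 ∧ (4 * eulerZigzag 5 - 4 * eulerZigzag 3 : ℤ) = 56 ∧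
      (5 * eulerZigzag 5 - 10 * eulerZigzag 3 + eulerZigzag 1 : ℤ) = 61 ∧
        [entringer 6 3, entringer 6 4, entringer 6 5] = [46, 56, 61] := by
  have h5 : eulerZigzag 5 = 16 := by decide
  have h3 : eulerZigzag 3 = 2 := by decide
  have h1 : eulerZigzag 1 = 1 := by decide
  refine ⟨by rw [h5, h3]; norm_num, by rw [h5, h3]; norm_num, by rw [h5, h3, h1]; norm_num, ?_⟩
  have h := entringer_row_five_six.2
  simp only [List.cons.injEq] at h
  simp [h]

/-! ### §2 The boustrophedon numbers `π(n,k,i)` and eq. (11) -/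

section Semiring

variable {R : Type*} [CommSemiring R]

/-- **The boustrophedon numbers `π(n,k,i)`** (`0 ≤ i, k ≤ n`): the entry `T_{n,k}` of the triangle (5) of the
sequence `δ_i = 0,…,0,1,0,…` (the `1` in position `i`), i.e. the coefficient of `a_i` in `T_{n,k}`.  In MSY
`π(n,k,i)` is «the number of paths in Γ from the node labeled T_{i,0} to the node labeled T_{n,k}» and «it follows
from the rule for constructing the triangle that the numbers T_{n,k} are given by (11) T_{n,k} = Σ_{i=0}^{n} π(n,k,i) a_i»;
we take the coefficient in (11) as the definition (the directed graph `Γ` and its paths are not formalized here).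
[cite: MillarSloaneYoung1996, §2 proof of Theorem 1 («Let π(n,k,i) denote the number of paths in Γ from the node labeled T_{i,0} to the node labeled T_{n,k}») and eq. (11)] -/
def pathCount (n k i : ℕ) : ℕ := triangle (fun j => if j = i then 1 else 0) n k

/-- Row `0`: `π(0,k,i) = [i = 0]`. [cite: MillarSloaneYoung1996, §2 eq. (5) («T_{n,0} = a_n») and eq. (11)] -/
theorem pathCount_zero_row (k i : ℕ) : pathCount 0 k i = if i = 0 then 1 else 0 := by
  rcases eq_or_ne i 0 with rfl | h
  · simp [pathCount, triangle]
  · simp [pathCount, triangle, h, h.symm]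

/-- The rule of the triangle for `π`: `π(n+1,k,i) = [i = n+1] + Σ_{j<k} π(n,n−j,i)` (a path to `T_{n+1,k}` is the
empty path from `T_{n+1,0}` when `i = n+1`, or enters row `n+1` from one of `T_{n,n}, …, T_{n,n−k+1}`).
[cite: MillarSloaneYoung1996, §2 eq. (5) and proof of Theorem 1 («It follows from the rule for constructing the triangle that the numbers T_{n,k} are given by (11)»)] -/
theorem pathCount_succ_row (n k i : ℕ) :
    pathCount (n + 1) k i = (if n + 1 = i then 1 else 0) + ∑ j ∈ range k, pathCount n (n - j) i := by
  unfold pathCount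
  rw [triangle]

/-- No path climbs: `π(n,k,i) = 0` for `i > n`. [cite: MillarSloaneYoung1996, §2 eq. (11) (the sum stops at i = n)] -/
theorem pathCount_eq_zero_of_lt : ∀ {n k i : ℕ}, n < i → pathCount n k i = 0
  | 0, k, i, h => by rw [pathCount_zero_row, if_neg (by omega)]
  | n + 1, k, i, h => by
      rw [pathCount_succ_row, if_neg (by omega), zero_add]
      exact sum_eq_zero fun j _ => pathCount_eq_zero_of_lt (by omega)

/-- `π(n,k,n) = 1`: from `T_{n,0}` the only path into row `n` is along the row.
[cite: MillarSloaneYoung1996, §2 Remark («π(n,0,n) = 1») and eq. (5)] -/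
theorem pathCount_self (n k : ℕ) : pathCount n k n = 1 := by
  cases n with
  | zero => rw [pathCount_zero_row, if_pos rfl]
  | succ n => rw [pathCount_succ_row, if_pos rfl, sum_eq_zero fun j _ => pathCount_eq_zero_of_lt (by omega), add_zero]

/-- For `i ≤ n`: `π(n+1,k,i) = Σ_{j<k} π(n,n−j,i)`. [cite: MillarSloaneYoung1996, §2 eq. (5) and eq. (11)] -/
theorem pathCount_succ_row_of_le {n k i : ℕ} (hi : i ≤ n) :
    pathCount (n + 1) k i = ∑ j ∈ range k, pathCount n (n - j) i := by
  rw [pathCount_succ_row, if_neg (by omega), zero_add]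

/-- ★★ **Eq. (11)**: `T_{n,k} = Σ_{i=0}^{n} π(n,k,i) a_i` — every entry of the triangle of `a` is the
`π`-weighted sum of `a_0, …, a_n` (over any commutative semiring; all `k`).
[cite: MillarSloaneYoung1996, §2 eq. (11) («T_{n,k} = Σ_{i=0}^{n} π(n,k,i) a_i»)] -/
theorem triangle_eq_sum_pathCount (a : ℕ → R) : ∀ n k : ℕ,
    triangle a n k = ∑ i ∈ range (n + 1), (pathCount n k i : R) * a i
  | 0, k => by simp [triangle, pathCount_zero_row]
  | n + 1, k => by
      rw [triangle, sum_range_succ, pathCount_self, Nat.cast_one, one_mul, add_comm (a (n + 1))]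
      congr 1
      rw [sum_congr rfl fun j _ => triangle_eq_sum_pathCount a n (n - j), sum_comm]
      refine sum_congr rfl fun i hi => ?_
      rw [pathCount_succ_row_of_le (Nat.lt_succ_iff.1 (mem_range.1 hi)), Nat.cast_sum, sum_mul]

/-- In particular `b_n = Σ_{i=0}^{n} π(n,n,i) a_i`. [cite: MillarSloaneYoung1996, §2 eq. (11) and «b_n = T_{n,n}»] -/
theorem transform_eq_sum_pathCount (a : ℕ → R) (n : ℕ) :
    transform a n = ∑ i ∈ range (n + 1), (pathCount n n i : R) * a i :=
  triangle_eq_sum_pathCount a n n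

end Semiring

/-! ### §3 The boustrophedon numbers in terms of the `E_n` (Remark, (12), Propositions 2–4) -/

/-- **Remark**: `π(n,0,i) = 0` for `0 ≤ i ≤ n−1` and `π(n,0,n) = 1`.
[cite: MillarSloaneYoung1996, §2 Remark («Note that π(n,0,i) = 0 for n ≥ 1, 0 ≤ i ≤ n−1, and π(n,0,n) = 1»)] -/
theorem pathCount_zero (n i : ℕ) : pathCount n 0 i = if i = n then 1 else 0 := by
  rcases eq_or_ne i n with rfl | h
  · rw [if_pos rfl, pathCount_self]
  · unfold pathCount
    rw [triangle_zero_right, if_neg h.symm, if_neg h]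

/-- **Eq. (12)** (Proposition 1): `π(n,n,0) = E_n`. [cite: MillarSloaneYoung1996, §2 eq. (12) («E_n = π(n,n,0) (n ≥ 0)») and Proposition 1] -/
theorem pathCount_end_zero (n : ℕ) : pathCount n n 0 = eulerZigzag n := by
  have h := transform_delta_zero (R := ℕ) n
  simpa [transform, pathCount] using h

/-- **Proposition 2**: `π(n,n,k) = binom(n,k) E_{n−k}` for `0 ≤ k ≤ n`.
[cite: MillarSloaneYoung1996, §2 Proposition 2 («π(n,n,k) = binom(n,k) E_{n−k}, for 0 ≤ k ≤ n»)] -/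
theorem pathCount_end {n i : ℕ} (hi : i ≤ n) : pathCount n n i = n.choose i * eulerZigzag (n - i) := by
  have h := transform_delta (R := ℕ) i n
  rw [if_pos hi] at h
  simpa [transform, pathCount] using h

/-- **Proposition 3**, first part: `π(n,k,0) = E_{n,k}` (`0 ≤ k ≤ n`).
[cite: MillarSloaneYoung1996, §2 Proposition 3 («π(n,k,0) = E_{n,k} follows from (11) and the definition of E_{n,k}»)] -/
theorem pathCount_source_zero {n k : ℕ} (hk : k ≤ n) : pathCount n k 0 = entringer n k := by
  have h := triangle_delta_zero (R := ℕ) hk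
  simpa [pathCount] using h

/-- ★★★ **Proposition 3** as printed: for `n ≥ 1`, `0 ≤ k ≤ n−1`,
`π(n,k,0) = E_{n,k} = Σ_{r=0}^{[(k−1)/2]} (−1)^r binom(k,2r+1) E_{n−2r−1}`.
[cite: MillarSloaneYoung1996, §2 Proposition 3; Entringer1966] -/
theorem proposition_three {n k : ℕ} (hn : 1 ≤ n) (hk : k ≤ n - 1) :
    (pathCount n k 0 : ℤ) = entringer n k ∧
      (entringer n k : ℤ) = ∑ r ∈ range ((k + 1) / 2),
        (-1 : ℤ) ^ r * (k.choose (2 * r + 1) : ℤ) * (eulerZigzag (n - 2 * r - 1) : ℤ) :=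
  ⟨by rw [pathCount_source_zero (by omega)], entringer_formula hn hk⟩

/-- Collapsing a sum against the indicator of `t + u = i`. [folklore] -/
private theorem sum_range_ite_add_eq (f : ℕ → ℕ) (m u i : ℕ) :
    (∑ t ∈ range (m + 1), if t + u = i then f t else 0) = if u ≤ i ∧ i - u ≤ m then f (i - u) else 0 := by
  split_ifs with h
  · rw [sum_eq_single (i - u) (fun t _ ht => if_neg (by omega))
      (fun h' => absurd (mem_range.2 (by omega)) h'), if_pos (by omega)]
  · exact sum_eq_zero fun t ht => if_neg fun h' => h ⟨by omega, by have := mem_range.1 ht; omega⟩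

/-- ★★ **Proposition 4**: for `0 ≤ i, k ≤ n`,
`π(n,k,i) = Σ_{s=0}^{n−i} binom(k,s) binom(n−k, n−i−s) π(n−i,s,0)` with `π(n−i,s,0) = E_{n−i,s}` — «the star in
the last row divides the remaining stars into two sets of sizes s (to the right) and n−i−s (to the left), and the
binomial coefficients count the ways in which the corresponding columns can be selected».  (The printed upper limit
is `min{k, n−i}`: the terms with `s > k` vanish.  Obtained here from the closed form `skew_eq_conv` of the whole
triangle.) [cite: MillarSloaneYoung1996, §2 Proposition 4 eq. (20) («π(n,k,i) = Σ_{s=0}^{min{k,n−i}} binom(k,s) binom(n−k,n−i−s) π(n−i,s,0)»)] -/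
theorem pathCount_eq_sum {n k i : ℕ} (hk : k ≤ n) (hi : i ≤ n) :
    pathCount n k i =
      ∑ s ∈ range (n - i + 1), k.choose s * ((n - k).choose (n - i - s) * entringer (n - i) s) := by
  obtain ⟨m, rfl⟩ : ∃ m, n = m + k := ⟨n - k, by omega⟩
  rw [Nat.add_sub_cancel]
  set g : ℕ → ℕ := fun s => k.choose s * (m.choose (m + k - i - s) * entringer (m + k - i) s) with hg
  have hg_k : ∀ s, k < s → g s = 0 := fun s hs => by
    simp only [hg, Nat.choose_eq_zero_of_lt hs, zero_mul]
  have hg_i : ∀ s, m + k - i < s → g s = 0 := fun s hs => by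
    simp only [hg, entringer_eq_zero_of_lt hs, mul_zero]
  -- Step 1: the closed form of the skew array, specialised to `δ_i`
  have h1 : pathCount (m + k) k i =
      ∑ u ∈ range (k + 1), if u ≤ i ∧ i - u ≤ m then
        m.choose (i - u) * k.choose u * entringer (m - (i - u) + (k - u)) (k - u) else 0 := by
    change skew (fun j => if j = i then (1 : ℕ) else 0) m k = _
    rw [skew_eq_conv, conv, sum_comm, Finset.Nat.sum_antidiagonal_eq_sum_range_succ_mk]
    refine sum_congr rfl fun u _ => ?_
    rw [Finset.Nat.sum_antidiagonal_eq_sum_range_succ_mk]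
    simp only [skewEntringer, Nat.cast_id, mul_ite, mul_one, mul_zero, ite_mul, zero_mul]
    exact sum_range_ite_add_eq _ m u i
  -- Step 2: after `u = k − s` the summand is `g s`
  have h2 : pathCount (m + k) k i = ∑ s ∈ range (k + 1), g s := by
    rw [h1, ← sum_range_reflect]
    refine sum_congr rfl fun s hs => ?_
    have hsk : s ≤ k := Nat.lt_succ_iff.1 (mem_range.1 hs)
    rw [show k + 1 - 1 - s = k - s by omega]
    split_ifs with hc
    · obtain ⟨hc1, hc2⟩ := hc
      rw [hg]
      dsimp only
      rw [show k - (k - s) = s by omega, show m - (i - (k - s)) + s = m + k - i by omega, Nat.choose_symm hsk,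
        Nat.choose_symm_of_eq_add (show m = (i - (k - s)) + (m + k - i - s) by omega)]
      ring
    · symm
      by_cases ha : i < k - s
      · simp only [hg, Nat.choose_eq_zero_of_lt (show m < m + k - i - s by omega), zero_mul, mul_zero]
      · exact hg_i s (by omega)
  -- Step 3: both ranges carry the support of `g`
  have hL : ∑ s ∈ range (k + 1), g s = ∑ s ∈ range (m + k + 1), g s :=
    sum_subset (fun x hx => mem_range.2 (by have := mem_range.1 hx; omega)) fun s _ hs =>
      hg_k s (by rw [mem_range, not_lt] at hs; omega)
  have hR : ∑ s ∈ range (m + k - i + 1), g s = ∑ s ∈ range (m + k + 1), g s :=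
    sum_subset (fun x hx => mem_range.2 (by have := mem_range.1 hx; omega)) fun s _ hs =>
      hg_i s (by rw [mem_range, not_lt] at hs; omega)
  rw [h2]
  exact hL.trans hR.symm

/-- Proposition 4 checked on `π(3,2,1) = 3 = binom(2,1)binom(1,1)E_{2,1} + binom(2,2)binom(1,0)E_{2,2}` and a few
more path counts. [cite: MillarSloaneYoung1996, §2 Proposition 4] -/
theorem pathCount_values :
    [pathCount 2 1 1, pathCount 3 1 1, pathCount 3 2 1, pathCount 3 3 1, pathCount 4 2 2, pathCount 5 3 2] =
      [1, 2, 3, 3, 5, 17] := by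
  decide

/-- ★ «Propositions 1–4 together express all the boustrophedon numbers in terms of the E_n's, and via (11) give an
explicit formula for every entry in the triangle (9)»: for `k ≤ n`,
`T_{n,k} = Σ_{i≤n} Σ_{s≤n−i} binom(k,s) binom(n−k,n−i−s) E_{n−i,s} a_i`.
[cite: MillarSloaneYoung1996, §2 (closing sentence after Proposition 4) and eq. (11)] -/
theorem triangle_explicit {R : Type*} [CommSemiring R] (a : ℕ → R) {n k : ℕ} (hk : k ≤ n) :
    triangle a n k = ∑ i ∈ range (n + 1),
      (∑ s ∈ range (n - i + 1), (k.choose s * ((n - k).choose (n - i - s) * entringer (n - i) s) : ℕ) : R) * a i := by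
  rw [triangle_eq_sum_pathCount]
  refine sum_congr rfl fun i hi => ?_
  rw [pathCount_eq_sum hk (Nat.lt_succ_iff.1 (mem_range.1 hi)), Nat.cast_sum]

end Boustrophedon
end Literature.Combinatorics.Enumerative
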